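import Literature.Analysis.InnerProduct.HilbertComplexDiscretenessInvariance
import HarnessLib

/-!
# Discreteness is invariant under complex isomorphisms — the outer Laplacians `T*T` and `SS*` (Brüning–Lesch 1992,
# Lemma 2.17, first sentence, degrees `0` and `N`)

Layer `Literature/Analysis/InnerProduct`, namespace `Literature.Analysis.InnerProduct`; sequel BY NAME of
`HilbertComplexDiscretenessInvariance.lean` (row g34-#11: `isCompactOperator_resolvent_of_rellich`,
`exists_hilbertBasis_of_rellich` for the middle Laplacian), `HilbertComplexCompactnessInvariance.lean` (row g34-#10:
`rellich_degree_zero_of_iso`, `rellich_degree_two_of_iso`), `HilbertComplexFormEmbeddingCompact.lean` (row g32: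
`exists_tendsto_subseq_of_form_bounded`), `HilbertComplexDiscreteSpectrum.lean` (row g32:
`exists_hilbertBasis_laplacian_eigenvectors`) and the zero-end bridges of `HilbertComplexEigenspaceSupersymmetry.lean`
(`laplacian_domain_iff_of_adjointCompSelf` / `laplacian_apply_of_adjointCompSelf` / `…_of_selfCompAdjoint`, presenting
`T*T` and `SS*` as the Laplacians of the windows `E →0 E →T F` and `F →S G →0 G`). Lane `lit-hodgefound` (Track 2
foundations library), prover seat `lit-hodgefound-p06` (generation 34), self-proposed row g34-#12. THEOREMS ONLY (no
definition, no instance, no named fact). `T*T` is hypothesis-parametrised by `hdomA`/`hvalA`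
(`D(T*T) = {w ∈ D(T) : Tw ∈ D(T*)}`), `SS*` by `hdomC`/`hvalC`; their resolvents by `hR : Rw ∈ D(·) ∧ Rw + (·)Rw = w`;
the Rellich properties are `‖w‖² + ‖Tw‖²` on `D(T)` and `‖z‖² + ‖S*z‖²` on `D(S*)`.

## Source, verbatim

J. Brüning, M. Lesch, *Hilbert complexes*, J. Funct. Anal. 108 (1992), §2 p. 104 (held text
`paper:doi-10-1016-0022-1236-92-90147-b`, p0017): "LEMMA 2.17. Discreteness is invariant under complex isomorphisms."
(p. 103: "`Δ` has a discrete spectrum; i.e., all spectral values are isolated eigenvalues of finite multiplicity,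
equivalently `spec_e Δ = ∅`. In this case we call the Hilbert complex `(𝒟, D)` discrete" — `Δ = ⊕ Δ_i`, so discreteness
is discreteness of every `Δ_i`; here `Δ_0 = T*T` and `Δ_2 = SS*` of the short complex.) K. Schmüdgen (2012), Prop. 10.6 /
Prop. 5.12: purely discrete spectrum ⟺ compact form embedding ⟺ compact resolvent.

## What is proved (all over `𝕜 = ℝ` or `ℂ`)

* §1 degree `0`: **`rellich_adjointCompSelf_of_hilbertBasis`** (an eigenbasis of `T*T` with `μᵢ → ∞`, `T` closed densely
  defined ⟹ every sequence bounded in `‖w‖² + ‖Tw‖²` has a convergent subsequence),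
  **`isCompactOperator_resolvent_adjointCompSelf_of_rellich`** (that Rellich property ⟹ `(1 + T*T)⁻¹` compact),
  **`exists_hilbertBasis_adjointCompSelf_of_rellich`**, and the end-to-end
  **`exists_hilbertBasis_adjointCompSelf_of_iso`**: `T*T` discrete, `(k_E, k_F)` a map `T′ → T` with `g_E ∘ k_E = id`,
  `R′` a resolvent of `T′*T′` ⟹ `T′*T′` has a Hilbert eigenbasis with `μ′ → ∞`.
* §2 degree `2`: the same four statements for `SS*` (`rellich_selfCompAdjoint_of_hilbertBasis`,
  `isCompactOperator_resolvent_selfCompAdjoint_of_rellich`, `exists_hilbertBasis_selfCompAdjoint_of_rellich`,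
  `exists_hilbertBasis_selfCompAdjoint_of_iso`, through `h = g_G*`).
Together with row g34-#11 (middle degree) this is Lemma 2.17's first sentence for all three Laplacians of the short complex.

## References

* [BruningLesch1992] J. Brüning, M. Lesch, *Hilbert complexes*, J. Funct. Anal. 108 (1992) 88–132, §2 Lemma 2.17, Cor 2.19.
* [Schmudgen2012] K. Schmüdgen, *Unbounded Self-adjoint Operators on Hilbert Space*, GTM 265, Prop. 5.12, Prop. 10.6.
* [Kato1966] T. Kato, *Perturbation Theory for Linear Operators*, III §6.8 Thm 6.29.
-/

noncomputable section

open scoped InnerProductSpace LinearPMap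
open Filter Topology

namespace Literature.Analysis.InnerProduct

variable {𝕜 E F G E' F' G' : Type*} [RCLike 𝕜]
variable [NormedAddCommGroup E] [InnerProductSpace 𝕜 E]
variable [NormedAddCommGroup F] [InnerProductSpace 𝕜 F]
variable [NormedAddCommGroup G] [InnerProductSpace 𝕜 G]
variable [NormedAddCommGroup E'] [InnerProductSpace 𝕜 E']
variable [NormedAddCommGroup F'] [InnerProductSpace 𝕜 F']
variable [NormedAddCommGroup G'] [InnerProductSpace 𝕜 G']

/-! ### §0 The zero end of a window -/

section Zero

variable {D : Type*} [NormedAddCommGroup D] [InnerProductSpace 𝕜 D]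

omit [NormedAddCommGroup F] [InnerProductSpace 𝕜 F] [NormedAddCommGroup G] [InnerProductSpace 𝕜 G]
  [NormedAddCommGroup E'] [InnerProductSpace 𝕜 E'] [NormedAddCommGroup F'] [InnerProductSpace 𝕜 F']
  [NormedAddCommGroup G'] [InnerProductSpace 𝕜 G'] in
/-- The zero operator is everywhere, hence densely, defined. [folklore] -/
private theorem dense_zero_pmap_domain : Dense (((0 : D →ₗ.[𝕜] E).domain : Submodule 𝕜 D) : Set D) := by
  rw [LinearPMap.zero_domain, Submodule.top_coe]; exact dense_univ

omit [NormedAddCommGroup F] [InnerProductSpace 𝕜 F] [NormedAddCommGroup G] [InnerProductSpace 𝕜 G]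
  [NormedAddCommGroup E'] [InnerProductSpace 𝕜 E'] [NormedAddCommGroup F'] [InnerProductSpace 𝕜 F']
  [NormedAddCommGroup G'] [InnerProductSpace 𝕜 G'] in
/-- The zero operator (domain everything) is closed: its graph is `D × {0}`. [folklore] -/
private theorem zero_pmap_isClosed : (0 : D →ₗ.[𝕜] E).IsClosed := by
  have hset : ((0 : D →ₗ.[𝕜] E).graph : Set (D × E)) = Set.univ ×ˢ {0} := by
    ext p
    rw [SetLike.mem_coe, LinearPMap.mem_graph_iff, Set.mem_prod]
    constructor
    · rintro ⟨y, -, hy⟩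
      rw [LinearPMap.zero_apply] at hy
      exact ⟨Set.mem_univ _, Set.mem_singleton_iff.2 hy.symm⟩
    · rintro ⟨-, hp⟩
      exact ⟨⟨p.1, Submodule.mem_top⟩, rfl, by rw [LinearPMap.zero_apply]; exact (Set.mem_singleton_iff.1 hp).symm⟩
  unfold LinearPMap.IsClosed
  rw [hset]
  exact isClosed_univ.prod isClosed_singleton

omit [NormedAddCommGroup F] [InnerProductSpace 𝕜 F] [NormedAddCommGroup G] [InnerProductSpace 𝕜 G]
  [NormedAddCommGroup E'] [InnerProductSpace 𝕜 E'] [NormedAddCommGroup F'] [InnerProductSpace 𝕜 F']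
  [NormedAddCommGroup G'] [InnerProductSpace 𝕜 G'] in
/-- `0* = 0` on `D(0*) =` everything. [folklore] -/
private theorem adjoint_zero_pmap_apply [CompleteSpace D] (y : E) :
    ∃ h : y ∈ (0 : D →ₗ.[𝕜] E)†.domain, (0 : D →ₗ.[𝕜] E)† ⟨y, h⟩ = 0 := by
  have key : ∀ x : (0 : D →ₗ.[𝕜] E).domain, ⟪(0 : D), (x : D)⟫_𝕜 = ⟪y, (0 : D →ₗ.[𝕜] E) x⟫_𝕜 := fun x ↦ by
    have h : ((0 : D →ₗ.[𝕜] E) x : E) = 0 := LinearPMap.zero_apply x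
    rw [h, inner_zero_left, inner_zero_right]
  exact ⟨LinearPMap.mem_adjoint_domain_of_exists _ ⟨0, key⟩,
    LinearPMap.adjoint_apply_eq dense_zero_pmap_domain ⟨y, _⟩ key⟩

end Zero

/-! ### §1 Degree `0`: `T*T` -/

section DegreeZero

variable [CompleteSpace E] [CompleteSpace F] [CompleteSpace E'] [CompleteSpace F']
variable {T : E →ₗ.[𝕜] F} {A : E →ₗ.[𝕜] E} {R : E →L[𝕜] E} {ι : Type*} {b : HilbertBasis ι 𝕜 E} {μ : ι → ℝ}
variable {T' : E' →ₗ.[𝕜] F'} {A' : E' →ₗ.[𝕜] E'} {R' : E' →L[𝕜] E'}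
variable {g_E : E →L[𝕜] E'} {k_E : E' →L[𝕜] E} {k_F : F' →L[𝕜] F}

omit [NormedAddCommGroup G] [InnerProductSpace 𝕜 G] [NormedAddCommGroup E'] [InnerProductSpace 𝕜 E']
  [NormedAddCommGroup F'] [InnerProductSpace 𝕜 F'] [NormedAddCommGroup G'] [InnerProductSpace 𝕜 G']
  [CompleteSpace E'] [CompleteSpace F'] in
/-- **A discrete `T*T` has the Rellich property**: if `T*T` (closed densely defined `T`) has a Hilbert basis of
eigenvectors with eigenvalues `μᵢ → ∞`, every sequence `wₙ ∈ D(T)` with `‖wₙ‖² + ‖Twₙ‖² ≤ C²` has a convergent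
subsequence (row g32's Rellich theorem for the window `E →0 E →T F`). [cite: Schmudgen2012, Prop. 10.6 ((iii) ⇒ (i));
BruningLesch1992, §2 Lemma 2.17 (discrete complexes)] -/
theorem rellich_adjointCompSelf_of_hilbertBasis (hdT : Dense (T.domain : Set E)) (hcT : T.IsClosed)
    (hdomA : ∀ x : E, x ∈ A.domain ↔ ∃ hx : x ∈ T.domain, T ⟨x, hx⟩ ∈ T†.domain)
    (hvalA : ∀ (x : A.domain) (hx : (x : E) ∈ T.domain) (hTx : T ⟨x, hx⟩ ∈ T†.domain),
      A x = T† ⟨T ⟨x, hx⟩, hTx⟩)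
    (heig : ∀ i, ∃ h : (b i : E) ∈ A.domain, A ⟨b i, h⟩ = ((μ i : ℝ) : 𝕜) • (b i : E))
    (htend : Tendsto μ cofinite atTop) (w : ℕ → E) (hw : ∀ n, w n ∈ T.domain) (C : ℝ)
    (hC : ∀ n, ‖w n‖ ^ 2 + ‖T ⟨w n, hw n⟩‖ ^ 2 ≤ C ^ 2) :
    ∃ v : E, ∃ φ : ℕ → ℕ, StrictMono φ ∧ Tendsto (w ∘ φ) atTop (𝓝 v) := by
  have h0 : ∀ n, ∃ h : w n ∈ (0 : E →ₗ.[𝕜] E)†.domain, (0 : E →ₗ.[𝕜] E)† ⟨w n, h⟩ = 0 := fun n ↦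
    adjoint_zero_pmap_apply (D := E) (w n)
  refine exists_tendsto_subseq_of_form_bounded (T := (0 : E →ₗ.[𝕜] E)) (S := T) dense_zero_pmap_domain hdT hcT
    (laplacian_domain_iff_of_adjointCompSelf hdomA) (laplacian_apply_of_adjointCompSelf hvalA) heig htend
    (fun n ↦ (h0 n).1) hw (C := C) fun n ↦ ?_
  rw [(h0 n).2, norm_zero]
  simpa using hC n

omit [NormedAddCommGroup G] [InnerProductSpace 𝕜 G] [NormedAddCommGroup E'] [InnerProductSpace 𝕜 E']
  [NormedAddCommGroup F'] [InnerProductSpace 𝕜 F'] [NormedAddCommGroup G'] [InnerProductSpace 𝕜 G']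
  [CompleteSpace F] [CompleteSpace E'] [CompleteSpace F'] in
/-- **The Rellich property of `T` makes `(1 + T*T)⁻¹` compact.** [cite: Schmudgen2012, Prop. 10.6, Prop. 5.12; Kato1966,
III §6.8 Thm 6.29] -/
theorem isCompactOperator_resolvent_adjointCompSelf_of_rellich (hdT : Dense (T.domain : Set E))
    (hdomA : ∀ x : E, x ∈ A.domain ↔ ∃ hx : x ∈ T.domain, T ⟨x, hx⟩ ∈ T†.domain)
    (hvalA : ∀ (x : A.domain) (hx : (x : E) ∈ T.domain) (hTx : T ⟨x, hx⟩ ∈ T†.domain),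
      A x = T† ⟨T ⟨x, hx⟩, hTx⟩)
    (hR : ∀ w : E, ∃ h : R w ∈ A.domain, R w + A ⟨R w, h⟩ = w)
    (hRel : ∀ (w : ℕ → E) (hw : ∀ n, w n ∈ T.domain) (C : ℝ),
      (∀ n, ‖w n‖ ^ 2 + ‖T ⟨w n, hw n⟩‖ ^ 2 ≤ C ^ 2) →
        ∃ v : E, ∃ φ : ℕ → ℕ, StrictMono φ ∧ Tendsto (w ∘ φ) atTop (𝓝 v)) :
    IsCompactOperator R := by
  refine isCompactOperator_resolvent_of_rellich (T := (0 : E →ₗ.[𝕜] E)) (S := T) dense_zero_pmap_domain hdT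
    (laplacian_domain_iff_of_adjointCompSelf hdomA) (laplacian_apply_of_adjointCompSelf hvalA) hR
    fun u huR huS C hC ↦ hRel u huS C fun n ↦ ?_
  have h := hC n
  nlinarith [sq_nonneg ‖(0 : E →ₗ.[𝕜] E)† ⟨u n, huR n⟩‖]

omit [NormedAddCommGroup G] [InnerProductSpace 𝕜 G] [NormedAddCommGroup E'] [InnerProductSpace 𝕜 E']
  [NormedAddCommGroup F'] [InnerProductSpace 𝕜 F'] [NormedAddCommGroup G'] [InnerProductSpace 𝕜 G']
  [CompleteSpace F] [CompleteSpace E'] [CompleteSpace F'] in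
/-- **Rellich property ⟹ `T*T` is discrete** (eigenbasis `b i = i ∈ s` with `0 ≤ μᵢ → ∞`, `R bᵢ = (1 + μᵢ)⁻¹bᵢ`).
[cite: Schmudgen2012, Prop. 10.6, Prop. 5.12; BruningLesch1992, §2 p. 103] -/
theorem exists_hilbertBasis_adjointCompSelf_of_rellich (hdT : Dense (T.domain : Set E))
    (hdomA : ∀ x : E, x ∈ A.domain ↔ ∃ hx : x ∈ T.domain, T ⟨x, hx⟩ ∈ T†.domain)
    (hvalA : ∀ (x : A.domain) (hx : (x : E) ∈ T.domain) (hTx : T ⟨x, hx⟩ ∈ T†.domain),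
      A x = T† ⟨T ⟨x, hx⟩, hTx⟩)
    (hR : ∀ w : E, ∃ h : R w ∈ A.domain, R w + A ⟨R w, h⟩ = w)
    (hRel : ∀ (w : ℕ → E) (hw : ∀ n, w n ∈ T.domain) (C : ℝ),
      (∀ n, ‖w n‖ ^ 2 + ‖T ⟨w n, hw n⟩‖ ^ 2 ≤ C ^ 2) →
        ∃ v : E, ∃ φ : ℕ → ℕ, StrictMono φ ∧ Tendsto (w ∘ φ) atTop (𝓝 v)) :
    ∃ (s : Set E) (b : HilbertBasis s 𝕜 E) (μ : s → ℝ), ⇑b = ((↑) : s → E) ∧ (∀ i, 0 ≤ μ i) ∧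
      (∀ i, ∃ h : (b i : E) ∈ A.domain, A ⟨b i, h⟩ = ((μ i : ℝ) : 𝕜) • (b i : E)) ∧
      (∀ i, R (b i) = (((1 + μ i)⁻¹ : ℝ) : 𝕜) • (b i : E)) ∧ Tendsto μ cofinite atTop :=
  exists_hilbertBasis_laplacian_eigenvectors (T := (0 : E →ₗ.[𝕜] E)) (S := T) dense_zero_pmap_domain hdT
    (laplacian_domain_iff_of_adjointCompSelf hdomA) (laplacian_apply_of_adjointCompSelf hvalA) hR
    (isCompactOperator_resolvent_adjointCompSelf_of_rellich hdT hdomA hvalA hR hRel)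

omit [NormedAddCommGroup G] [InnerProductSpace 𝕜 G] [NormedAddCommGroup G'] [InnerProductSpace 𝕜 G']
  [CompleteSpace F'] in
/-- **Lemma 2.17, first sentence, degree `0`: an isomorphic image of a complex with discrete `T*T` has discrete `T′*T′`.**
`T` closed densely defined with an eigenbasis of `T*T` (`μᵢ → ∞`); `T′` densely defined with a resolvent `R′` of `T′*T′`;
`(k_E, k_F)` a bounded map of complexes `T′ → T` (`T k_E = k_F T′` on `D(T′)`) with `g_E ∘ k_E = id`. Then `T′*T′` has a
Hilbert basis of eigenvectors with eigenvalues `0 ≤ μ′ⱼ → ∞`. [cite: BruningLesch1992, §2 Lemma 2.17, Cor 2.19;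
Schmudgen2012, Prop. 10.6, Prop. 5.12] -/
theorem exists_hilbertBasis_adjointCompSelf_of_iso (hdT : Dense (T.domain : Set E)) (hcT : T.IsClosed)
    (hdomA : ∀ x : E, x ∈ A.domain ↔ ∃ hx : x ∈ T.domain, T ⟨x, hx⟩ ∈ T†.domain)
    (hvalA : ∀ (x : A.domain) (hx : (x : E) ∈ T.domain) (hTx : T ⟨x, hx⟩ ∈ T†.domain),
      A x = T† ⟨T ⟨x, hx⟩, hTx⟩)
    (heig : ∀ i, ∃ h : (b i : E) ∈ A.domain, A ⟨b i, h⟩ = ((μ i : ℝ) : 𝕜) • (b i : E))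
    (htend : Tendsto μ cofinite atTop)
    (hdT' : Dense (T'.domain : Set E'))
    (hdomA' : ∀ x : E', x ∈ A'.domain ↔ ∃ hx : x ∈ T'.domain, T' ⟨x, hx⟩ ∈ T'†.domain)
    (hvalA' : ∀ (x : A'.domain) (hx : (x : E') ∈ T'.domain) (hTx : T' ⟨x, hx⟩ ∈ T'†.domain),
      A' x = T'† ⟨T' ⟨x, hx⟩, hTx⟩)
    (hR' : ∀ w : E', ∃ h : R' w ∈ A'.domain, R' w + A' ⟨R' w, h⟩ = w)
    (hkT : ∀ (w' : E') (hw' : w' ∈ T'.domain), ∃ h : k_E w' ∈ T.domain, T ⟨k_E w', h⟩ = k_F (T' ⟨w', hw'⟩))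
    (hgk_E : ∀ w' : E', g_E (k_E w') = w') :
    ∃ (s : Set E') (b' : HilbertBasis s 𝕜 E') (μ' : s → ℝ), ⇑b' = ((↑) : s → E') ∧ (∀ j, 0 ≤ μ' j) ∧
      (∀ j, ∃ h : (b' j : E') ∈ A'.domain, A' ⟨b' j, h⟩ = ((μ' j : ℝ) : 𝕜) • (b' j : E')) ∧
      (∀ j, R' (b' j) = (((1 + μ' j)⁻¹ : ℝ) : 𝕜) • (b' j : E')) ∧ Tendsto μ' cofinite atTop :=
  exists_hilbertBasis_adjointCompSelf_of_rellich hdT' hdomA' hvalA' hR'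
    (rellich_degree_zero_of_iso hkT hgk_E
      (rellich_adjointCompSelf_of_hilbertBasis hdT hcT hdomA hvalA heig htend))

end DegreeZero

/-! ### §2 Degree `2`: `SS*` -/

section DegreeTwo

variable [CompleteSpace F] [CompleteSpace G] [CompleteSpace F'] [CompleteSpace G']
variable {S : F →ₗ.[𝕜] G} {C : G →ₗ.[𝕜] G} {R : G →L[𝕜] G} {ι : Type*} {b : HilbertBasis ι 𝕜 G} {μ : ι → ℝ}
variable {S' : F' →ₗ.[𝕜] G'} {C' : G' →ₗ.[𝕜] G'} {R' : G' →L[𝕜] G'}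
variable {g_F : F →L[𝕜] F'} {g_G : G →L[𝕜] G'} {k_G : G' →L[𝕜] G}

omit [NormedAddCommGroup E] [InnerProductSpace 𝕜 E] [NormedAddCommGroup E'] [InnerProductSpace 𝕜 E']
  [NormedAddCommGroup F'] [InnerProductSpace 𝕜 F'] [NormedAddCommGroup G'] [InnerProductSpace 𝕜 G']
  [CompleteSpace F'] [CompleteSpace G'] in
/-- **A discrete `SS*` has the Rellich property**: if `SS*` (`S` densely defined) has a Hilbert basis of eigenvectors with
`μᵢ → ∞`, every sequence `zₙ ∈ D(S*)` with `‖zₙ‖² + ‖S*zₙ‖² ≤ M²` has a convergent subsequence (row g32's Rellich theorem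
for the window `F →S G →0 G`). [cite: Schmudgen2012, Prop. 10.6; BruningLesch1992, §2 Lemma 2.17] -/
theorem rellich_selfCompAdjoint_of_hilbertBasis (hdS : Dense (S.domain : Set F))
    (hdomC : ∀ y : G, y ∈ C.domain ↔ ∃ hy : y ∈ S†.domain, S† ⟨y, hy⟩ ∈ S.domain)
    (hvalC : ∀ (y : C.domain) (hy : (y : G) ∈ S†.domain) (hSy : S† ⟨y, hy⟩ ∈ S.domain),
      C y = S ⟨S† ⟨y, hy⟩, hSy⟩)
    (heig : ∀ i, ∃ h : (b i : G) ∈ C.domain, C ⟨b i, h⟩ = ((μ i : ℝ) : 𝕜) • (b i : G))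
    (htend : Tendsto μ cofinite atTop) (z : ℕ → G) (hz : ∀ n, z n ∈ S†.domain) (M : ℝ)
    (hM : ∀ n, ‖z n‖ ^ 2 + ‖S† ⟨z n, hz n⟩‖ ^ 2 ≤ M ^ 2) :
    ∃ v : G, ∃ φ : ℕ → ℕ, StrictMono φ ∧ Tendsto (z ∘ φ) atTop (𝓝 v) := by
  refine exists_tendsto_subseq_of_form_bounded (T := S) (S := (0 : G →ₗ.[𝕜] G)) hdS dense_zero_pmap_domain
    zero_pmap_isClosed (laplacian_domain_iff_of_selfCompAdjoint hdomC) (laplacian_apply_of_selfCompAdjoint hvalC)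
    heig htend hz (fun _ ↦ Submodule.mem_top) (C := M) fun n ↦ ?_
  rw [LinearPMap.zero_apply, norm_zero]
  simpa using hM n

omit [NormedAddCommGroup E] [InnerProductSpace 𝕜 E] [NormedAddCommGroup E'] [InnerProductSpace 𝕜 E']
  [NormedAddCommGroup F'] [InnerProductSpace 𝕜 F'] [NormedAddCommGroup G'] [InnerProductSpace 𝕜 G']
  [CompleteSpace F'] [CompleteSpace G'] in
/-- **The Rellich property of `S*` makes `(1 + SS*)⁻¹` compact.** [cite: Schmudgen2012, Prop. 10.6, Prop. 5.12; Kato1966,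
III §6.8 Thm 6.29] -/
theorem isCompactOperator_resolvent_selfCompAdjoint_of_rellich (hdS : Dense (S.domain : Set F))
    (hdomC : ∀ y : G, y ∈ C.domain ↔ ∃ hy : y ∈ S†.domain, S† ⟨y, hy⟩ ∈ S.domain)
    (hvalC : ∀ (y : C.domain) (hy : (y : G) ∈ S†.domain) (hSy : S† ⟨y, hy⟩ ∈ S.domain),
      C y = S ⟨S† ⟨y, hy⟩, hSy⟩)
    (hR : ∀ z : G, ∃ h : R z ∈ C.domain, R z + C ⟨R z, h⟩ = z)
    (hRel : ∀ (z : ℕ → G) (hz : ∀ n, z n ∈ S†.domain) (M : ℝ),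
      (∀ n, ‖z n‖ ^ 2 + ‖S† ⟨z n, hz n⟩‖ ^ 2 ≤ M ^ 2) →
        ∃ v : G, ∃ φ : ℕ → ℕ, StrictMono φ ∧ Tendsto (z ∘ φ) atTop (𝓝 v)) :
    IsCompactOperator R := by
  refine isCompactOperator_resolvent_of_rellich (T := S) (S := (0 : G →ₗ.[𝕜] G)) hdS dense_zero_pmap_domain
    (laplacian_domain_iff_of_selfCompAdjoint hdomC) (laplacian_apply_of_selfCompAdjoint hvalC) hR
    fun u huT huU M hM ↦ hRel u huT M fun n ↦ ?_
  have h := hM n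
  nlinarith [sq_nonneg ‖(0 : G →ₗ.[𝕜] G) ⟨u n, huU n⟩‖]

omit [NormedAddCommGroup E] [InnerProductSpace 𝕜 E] [NormedAddCommGroup E'] [InnerProductSpace 𝕜 E']
  [NormedAddCommGroup F'] [InnerProductSpace 𝕜 F'] [NormedAddCommGroup G'] [InnerProductSpace 𝕜 G']
  [CompleteSpace F'] [CompleteSpace G'] in
/-- **Rellich property ⟹ `SS*` is discrete.** [cite: Schmudgen2012, Prop. 10.6, Prop. 5.12; BruningLesch1992, §2 p. 103] -/
theorem exists_hilbertBasis_selfCompAdjoint_of_rellich (hdS : Dense (S.domain : Set F))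
    (hdomC : ∀ y : G, y ∈ C.domain ↔ ∃ hy : y ∈ S†.domain, S† ⟨y, hy⟩ ∈ S.domain)
    (hvalC : ∀ (y : C.domain) (hy : (y : G) ∈ S†.domain) (hSy : S† ⟨y, hy⟩ ∈ S.domain),
      C y = S ⟨S† ⟨y, hy⟩, hSy⟩)
    (hR : ∀ z : G, ∃ h : R z ∈ C.domain, R z + C ⟨R z, h⟩ = z)
    (hRel : ∀ (z : ℕ → G) (hz : ∀ n, z n ∈ S†.domain) (M : ℝ),
      (∀ n, ‖z n‖ ^ 2 + ‖S† ⟨z n, hz n⟩‖ ^ 2 ≤ M ^ 2) →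
        ∃ v : G, ∃ φ : ℕ → ℕ, StrictMono φ ∧ Tendsto (z ∘ φ) atTop (𝓝 v)) :
    ∃ (s : Set G) (b : HilbertBasis s 𝕜 G) (μ : s → ℝ), ⇑b = ((↑) : s → G) ∧ (∀ i, 0 ≤ μ i) ∧
      (∀ i, ∃ h : (b i : G) ∈ C.domain, C ⟨b i, h⟩ = ((μ i : ℝ) : 𝕜) • (b i : G)) ∧
      (∀ i, R (b i) = (((1 + μ i)⁻¹ : ℝ) : 𝕜) • (b i : G)) ∧ Tendsto μ cofinite atTop :=
  exists_hilbertBasis_laplacian_eigenvectors (T := S) (S := (0 : G →ₗ.[𝕜] G)) hdS dense_zero_pmap_domain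
    (laplacian_domain_iff_of_selfCompAdjoint hdomC) (laplacian_apply_of_selfCompAdjoint hvalC) hR
    (isCompactOperator_resolvent_selfCompAdjoint_of_rellich hdS hdomC hvalC hR hRel)

omit [NormedAddCommGroup E] [InnerProductSpace 𝕜 E] [NormedAddCommGroup E'] [InnerProductSpace 𝕜 E'] in
/-- **Lemma 2.17, first sentence, degree `2`: an isomorphic image of a complex with discrete `SS*` has discrete `S′S′*`.**
`S`, `S′` densely defined, `SS*` with an eigenbasis (`μᵢ → ∞`), `S′S′*` with a resolvent `R′`; `(g_F, g_G)` a bounded map of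
complexes `S → S′` (`S′g_F = g_G S` on `D(S)`) and `g_G ∘ k_G = id`. Then `S′S′*` has a Hilbert basis of eigenvectors with
eigenvalues `0 ≤ μ′ⱼ → ∞` (through `h = g_G*`). [cite: BruningLesch1992, §2 Lemma 2.17, p. 103 (`h := (g⁻¹)*`), Cor 2.19;
Schmudgen2012, Prop. 10.6, Prop. 5.12] -/
theorem exists_hilbertBasis_selfCompAdjoint_of_iso (hdS : Dense (S.domain : Set F))
    (hdomC : ∀ y : G, y ∈ C.domain ↔ ∃ hy : y ∈ S†.domain, S† ⟨y, hy⟩ ∈ S.domain)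
    (hvalC : ∀ (y : C.domain) (hy : (y : G) ∈ S†.domain) (hSy : S† ⟨y, hy⟩ ∈ S.domain),
      C y = S ⟨S† ⟨y, hy⟩, hSy⟩)
    (heig : ∀ i, ∃ h : (b i : G) ∈ C.domain, C ⟨b i, h⟩ = ((μ i : ℝ) : 𝕜) • (b i : G))
    (htend : Tendsto μ cofinite atTop)
    (hdS' : Dense (S'.domain : Set F'))
    (hdomC' : ∀ y : G', y ∈ C'.domain ↔ ∃ hy : y ∈ S'†.domain, S'† ⟨y, hy⟩ ∈ S'.domain)
    (hvalC' : ∀ (y : C'.domain) (hy : (y : G') ∈ S'†.domain) (hSy : S'† ⟨y, hy⟩ ∈ S'.domain),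
      C' y = S' ⟨S'† ⟨y, hy⟩, hSy⟩)
    (hR' : ∀ z : G', ∃ h : R' z ∈ C'.domain, R' z + C' ⟨R' z, h⟩ = z)
    (hgS : ∀ (u : F) (hu : u ∈ S.domain), ∃ h : g_F u ∈ S'.domain, S' ⟨g_F u, h⟩ = g_G (S ⟨u, hu⟩))
    (hgk_G : ∀ z' : G', g_G (k_G z') = z') :
    ∃ (s : Set G') (b' : HilbertBasis s 𝕜 G') (μ' : s → ℝ), ⇑b' = ((↑) : s → G') ∧ (∀ j, 0 ≤ μ' j) ∧
      (∀ j, ∃ h : (b' j : G') ∈ C'.domain, C' ⟨b' j, h⟩ = ((μ' j : ℝ) : 𝕜) • (b' j : G')) ∧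
      (∀ j, R' (b' j) = (((1 + μ' j)⁻¹ : ℝ) : 𝕜) • (b' j : G')) ∧ Tendsto μ' cofinite atTop :=
  exists_hilbertBasis_selfCompAdjoint_of_rellich hdS' hdomC' hvalC' hR'
    (rellich_degree_two_of_iso hdS hdS' hgS hgk_G
      (rellich_selfCompAdjoint_of_hilbertBasis hdS hdomC hvalC heig htend))

end DegreeTwo

end Literature.Analysis.InnerProduct
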